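import Summits.Ventures.WeilGRH.TwistedFlatTest
import Summits.Ventures.WeilGRH.TwistedFlatTestBounds
import Mathlib.NumberTheory.Chebyshev
import HarnessLib

/-!
# GRH arm (rh-explicit, venture WeilGRH): the flat-window inequality with NUMBERS — conductor floors,
  and the least non-trivial prime power under `GRH(χ)` via Weil positivity

Cell `rh-explicit`, WEIL TRACK (structure seat weil-3, gen7) for the GRH ARM.  `TwistedFlatTest.lean` proves,
for every `χ` mod `q ≠ 1` and `a > 0`, `WeilPositivityOnChar χ a ⟹ 2S_χ(a) + K_κ − I_κ(a)/a ≤ log q`;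
`TwistedFlatTestBounds.lean` gives `K_κ ≥ 2.23` (`K₀ ≥ 5.3716`) and `I_κ(a) ≤ 5`.  Here:

* `flatWindow_floor_le_log_of_weilPositivityOnChar`: **`2S_χ(a) + 2.23 − 5/a ≤ log q`** (any parity;
  `+ 5.3716` for even `χ`, `flatWindow_floor_le_log_of_weilPositivityOnChar_of_even`), with
  `S_χ(a) = Σ_{log n<2a} Λ(n)n^{-1/2}(1 − log n/(2a)) Re χ(n)` an explicit FINITE sum;
* the Chebyshev evaluation of the trivial-key sum (`two_mul_log_two_mul_exp_le_flatSum`, Mathlib's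
  `Chebyshev.psi_ge'`: `ψ(x) ≥ (x − 1)log 2 − log(x + 2)`): for `a ≥ 1`,
  `2Σ_{log n<2a} Λ(n)n^{-1/2}(1 − log n/(2a)) ≥ 2 log 2 · e^{a−1}/a − 2 log 2 − 4`;
* hence the EXPLICIT TRIVIAL-KEY FLOOR (`exp_floor_le_log_of_weilPositivityOnChar_of_trivial`): for `a ≥ 1`,
  `WeilPositivityOnChar χ a` and `χ(n) = 1` for all prime powers `n < e^{2a}` force
  **`2 log 2 · e^{a−1}/a − 33/4 ≤ log q`**;
* and under `GRH(χ)` (`χ` primitive mod `q ≠ 1`), in the classical shape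
  (`exists_primePower_lt_chi_ne_one_of_grh`): for every real `x ≥ e²` with
  **`log q < (4 log 2/e)·√x/log x − 33/4`** there is a prime power `n < x` with `χ(n) ≠ 1` — the least
  character non-residue (or a prime dividing `q`) is `≪ (log q · log log q)²`, by Weil POSITIVITY at one
  window (Ankeny 1952 / Montgomery–Vaughan Thm 13.11 / Bach 1990: `≪ (log q)²` by the density of zeros; the
  optimal positivity window `cosh(x/2)𝟙` would give Bach's `(1 + o(1))(log q)²`, not typed here).

No definitions, no named facts; the `_of_grh` statements take `GRH(χ)` as a hypothesis.

## References

* H. L. Montgomery, R. C. Vaughan, *Multiplicative Number Theory I* (2007), §13.2, Theorem 13.11.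
  [MontgomeryVaughan2007]
* E. Bach, *Explicit bounds for primality testing and related problems*, Math. Comp. 55 (1990) 355–380,
  Theorems 1–3. [Bach1990]
-/

set_option autoImplicit false

noncomputable section

open Complex Filter Set MeasureTheory
open scoped Real Topology ComplexConjugate ArithmeticFunction.vonMangoldt Chebyshev

namespace Summit.Ventures.WeilGRH

open Literature.NumberTheory.LFunctions

variable {q : ℕ} {a : ℝ}

/-! ## The floor with numbers -/

/-- **THE FLAT-WINDOW FLOOR WITH NUMBERS**: for every `χ` mod `q ≠ 1` and `a > 0`,
`WeilPositivityOnChar χ a ⟹ 2Σ_{log n<2a} Λ(n)n^{-1/2}(1 − log n/(2a)) Re χ(n) + 2.23 − 5/a ≤ log q`. -/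
theorem flatWindow_floor_le_log_of_weilPositivityOnChar (hq : q ≠ 1) (χ : DirichletCharacter ℂ q)
    (ha : 0 < a) (hW : WeilPositivityOnChar χ a) :
    2 * (∑ n ∈ weilPrimeIndex a,
          (Λ n : ℝ) / Real.sqrt n * ((1 - Real.log n / (2 * a)) * (χ (n : ZMod q)).re)) +
        2.23 - 5 / a ≤ Real.log q := by
  have h := flatWindow_le_log_of_weilPositivityOnChar hq χ ha hW
  have hK := flatWindow_const_ge χ
  have hI := integral_weilArchDensityPar_mul_min_le_five (charParity χ) ha.le
  have hIa : 1 / a * ∫ t in Ioi (0 : ℝ), weilArchDensityPar (charParity χ) t * min t (2 * a) ≤ 5 / a := by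
    rw [one_div_mul_eq_div]
    exact div_le_div_of_nonneg_right hI ha.le
  linarith

/-- The same for EVEN characters with the even constant: `… + 5.3716 − 5/a ≤ log q`. -/
theorem flatWindow_floor_le_log_of_weilPositivityOnChar_of_even (hq : q ≠ 1)
    (χ : DirichletCharacter ℂ q) (hχ : χ.Even) (ha : 0 < a) (hW : WeilPositivityOnChar χ a) :
    2 * (∑ n ∈ weilPrimeIndex a,
          (Λ n : ℝ) / Real.sqrt n * ((1 - Real.log n / (2 * a)) * (χ (n : ZMod q)).re)) +
        5.3716 - 5 / a ≤ Real.log q := by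
  have h := flatWindow_le_log_of_weilPositivityOnChar hq χ ha hW
  rw [charParity_of_even hχ] at h
  have hK := flatWindow_const_zero_ge
  have hI := integral_weilArchDensityPar_mul_min_le_five 0 ha.le
  have hIa : 1 / a * ∫ t in Ioi (0 : ℝ), weilArchDensityPar 0 t * min t (2 * a) ≤ 5 / a := by
    rw [one_div_mul_eq_div]
    exact div_le_div_of_nonneg_right hI ha.le
  linarith

/-- **Trivial key, with numbers**: `WeilPositivityOnChar χ a` and `χ(n) = 1` for all prime powers
`n < e^{2a}` force `2Σ_{log n<2a} Λ(n)n^{-1/2}(1 − log n/(2a)) + 2.23 − 5/a ≤ log q`. -/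
theorem flatWindow_floor_le_log_of_weilPositivityOnChar_of_trivial (hq : q ≠ 1)
    (χ : DirichletCharacter ℂ q) (ha : 0 < a) (hW : WeilPositivityOnChar χ a)
    (hkey : ∀ n ∈ weilPrimeIndex a, Λ n ≠ 0 → χ (n : ZMod q) = 1) :
    2 * (∑ n ∈ weilPrimeIndex a, (Λ n : ℝ) / Real.sqrt n * (1 - Real.log n / (2 * a))) +
        2.23 - 5 / a ≤ Real.log q := by
  have h := flatWindow_le_log_of_weilPositivityOnChar_of_trivial hq χ ha hW hkey
  have hK := flatWindow_const_ge χ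
  have hI := integral_weilArchDensityPar_mul_min_le_five (charParity χ) ha.le
  have hIa : 1 / a * ∫ t in Ioi (0 : ℝ), weilArchDensityPar (charParity χ) t * min t (2 * a) ≤ 5 / a := by
    rw [one_div_mul_eq_div]
    exact div_le_div_of_nonneg_right hI ha.le
  linarith

/-! ## The trivial-key prime sum through Chebyshev's `ψ` -/

/-- Each term of the flat-window prime sum is non-negative on the window. -/
theorem flatSum_term_nonneg (ha : 0 < a) {n : ℕ} (hn : n ∈ weilPrimeIndex a) :
    0 ≤ (Λ n : ℝ) / Real.sqrt n * (1 - Real.log n / (2 * a)) := by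
  have hlog : Real.log n < 2 * a := mem_weilPrimeIndex.1 hn
  refine mul_nonneg (div_nonneg ArithmeticFunction.vonMangoldt_nonneg (Real.sqrt_nonneg _)) ?_
  rw [sub_nonneg, div_le_one (by linarith)]
  exact hlog.le

/-- **The flat-window prime sum dominates `ψ(e^{2a−2})/(a e^{a−1})`**: the prime powers `n ≤ e^{2a−2}` lie
in the window with weight `1 − log n/(2a) ≥ 1/a` and `n^{-1/2} ≥ e^{1−a}`. -/
theorem psi_div_le_flatSum (ha : 0 < a) :
    ψ (Real.exp (2 * a - 2)) / (a * Real.exp (a - 1)) ≤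
      ∑ n ∈ weilPrimeIndex a, (Λ n : ℝ) / Real.sqrt n * (1 - Real.log n / (2 * a)) := by
  set X : ℝ := Real.exp (2 * a - 2) with hX
  have hX0 : 0 < X := Real.exp_pos _
  have hsqrtX : Real.sqrt X = Real.exp (a - 1) := by
    rw [hX, show 2 * a - 2 = (a - 1) + (a - 1) by ring, Real.exp_add, Real.sqrt_mul_self (Real.exp_pos _).le]
  have hsub : Finset.Ioc 0 ⌊X⌋₊ ⊆ weilPrimeIndex a := by
    intro n hn
    rw [Finset.mem_Ioc] at hn
    rw [mem_weilPrimeIndex]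
    have hn1 : (0 : ℝ) < n := by exact_mod_cast hn.1
    have hnX : (n : ℝ) ≤ X := (Nat.cast_le.2 hn.2).trans (Nat.floor_le hX0.le)
    calc Real.log n ≤ Real.log X := Real.log_le_log hn1 hnX
      _ = 2 * a - 2 := Real.log_exp _
      _ < 2 * a := by linarith
  -- termwise on `Ioc 0 ⌊X⌋`: `Λ(n)/(a e^{a-1}) ≤ Λ(n) n^{-1/2} (1 − log n/(2a))`
  have hterm : ∀ n ∈ Finset.Ioc 0 ⌊X⌋₊,
      (Λ n : ℝ) / (a * Real.exp (a - 1)) ≤ (Λ n : ℝ) / Real.sqrt n * (1 - Real.log n / (2 * a)) := by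
    intro n hn
    rw [Finset.mem_Ioc] at hn
    have hn1 : (0 : ℝ) < n := by exact_mod_cast hn.1
    have hnX : (n : ℝ) ≤ X := (Nat.cast_le.2 hn.2).trans (Nat.floor_le hX0.le)
    have hlog : Real.log n ≤ 2 * a - 2 := by
      calc Real.log n ≤ Real.log X := Real.log_le_log hn1 hnX
        _ = 2 * a - 2 := Real.log_exp _
    have hw : 1 / a ≤ 1 - Real.log n / (2 * a) := by
      have h1 : Real.log n / (2 * a) ≤ (2 * a - 2) / (2 * a) :=
        div_le_div_of_nonneg_right hlog (by linarith)
      have h2 : (2 * a - 2) / (2 * a) = 1 - 1 / a := by field_simp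
      linarith [h1, h2.le, h2.ge]
    have hsq : Real.sqrt n ≤ Real.exp (a - 1) := by
      rw [← hsqrtX]; exact Real.sqrt_le_sqrt hnX
    have hsq0 : 0 < Real.sqrt n := Real.sqrt_pos.2 hn1
    have hΛ : 0 ≤ (Λ n : ℝ) := ArithmeticFunction.vonMangoldt_nonneg
    calc (Λ n : ℝ) / (a * Real.exp (a - 1)) = (Λ n : ℝ) / Real.exp (a - 1) * (1 / a) := by
          field_simp
      _ ≤ (Λ n : ℝ) / Real.sqrt n * (1 - Real.log n / (2 * a)) := by
          gcongr
  calc ψ X / (a * Real.exp (a - 1))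
      = ∑ n ∈ Finset.Ioc 0 ⌊X⌋₊, (Λ n : ℝ) / (a * Real.exp (a - 1)) := by
        rw [Chebyshev.psi, Finset.sum_div]
    _ ≤ ∑ n ∈ Finset.Ioc 0 ⌊X⌋₊, (Λ n : ℝ) / Real.sqrt n * (1 - Real.log n / (2 * a)) :=
        Finset.sum_le_sum hterm
    _ ≤ ∑ n ∈ weilPrimeIndex a, (Λ n : ℝ) / Real.sqrt n * (1 - Real.log n / (2 * a)) :=
        Finset.sum_le_sum_of_subset_of_nonneg hsub fun n hn _ ↦ flatSum_term_nonneg ha hn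

/-- **Chebyshev evaluation of the trivial-key sum**: for `a ≥ 1`,
`2 log 2 · e^{a−1}/a − 2 log 2 − 4 ≤ 2Σ_{log n<2a} Λ(n)n^{-1/2}(1 − log n/(2a))`
(`ψ(X) ≥ (X − 1)log 2 − log(X + 2)` at `X = e^{2a−2} ≥ 1`, `log(X + 2) ≤ log 3 + 2a − 2`). -/
theorem two_mul_log_two_mul_exp_le_flatSum (ha : 1 ≤ a) :
    2 * Real.log 2 * Real.exp (a - 1) / a - 2 * Real.log 2 - 4 ≤
      2 * ∑ n ∈ weilPrimeIndex a, (Λ n : ℝ) / Real.sqrt n * (1 - Real.log n / (2 * a)) := by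
  have ha0 : 0 < a := by linarith
  set X : ℝ := Real.exp (2 * a - 2) with hX
  set E : ℝ := Real.exp (a - 1) with hE
  have hE1 : 1 ≤ E := by rw [hE]; exact Real.one_le_exp (by linarith)
  have hE0 : 0 < E := by linarith
  have hXE : X = E * E := by rw [hX, hE, ← Real.exp_add]; congr 1; ring
  have hX1 : 1 ≤ X := by rw [hXE]; nlinarith
  have hpsi := Chebyshev.psi_ge' (x := X) (by linarith)
  have hS := psi_div_le_flatSum ha0 (a := a)
  rw [← hX, ← hE] at hS
  -- `log(X + 2) ≤ log 3 + (2a − 2)` and `log 2 + log 3 = log 6 < 2`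
  have hlog3 : Real.log (X + 2) ≤ Real.log 3 + (2 * a - 2) := by
    have h3X : X + 2 ≤ 3 * X := by linarith
    calc Real.log (X + 2) ≤ Real.log (3 * X) := Real.log_le_log (by linarith) h3X
      _ = Real.log 3 + Real.log X := Real.log_mul (by norm_num) (by linarith)
      _ = Real.log 3 + (2 * a - 2) := by rw [hX, Real.log_exp]
  have hlog6 : Real.log 2 + Real.log 3 < 2 := by
    have he := Real.exp_one_gt_d9
    have h6 : (6 : ℝ) < Real.exp 2 := by
      have : Real.exp 2 = Real.exp 1 ^ 2 := by rw [← Real.exp_nat_mul]; norm_num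
      rw [this]; nlinarith
    calc Real.log 2 + Real.log 3 = Real.log 6 := by
          rw [← Real.log_mul (by norm_num) (by norm_num)]; norm_num
      _ < Real.log (Real.exp 2) := Real.log_lt_log (by norm_num) h6
      _ = 2 := Real.log_exp 2
  have hlog2' : 0 < Real.log 2 := Real.log_pos one_lt_two
  have hLpos : 0 ≤ Real.log (X + 2) := Real.log_nonneg (by linarith)
  have haE : 0 < a * E := mul_pos ha0 hE0
  -- `ψ X / (a E) ≥ ((X − 1) log 2 − log (X+2)) / (a E) = log 2 · E/a − (log 2 + log(X+2))/(aE)`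
  have h1 : ((X - 1) * Real.log 2 - Real.log (X + 2)) / (a * E) ≤ ψ X / (a * E) :=
    div_le_div_of_nonneg_right hpsi haE.le
  have hsplit : ((X - 1) * Real.log 2 - Real.log (X + 2)) / (a * E) =
      Real.log 2 * E / a - (Real.log 2 + Real.log (X + 2)) / (a * E) := by
    rw [hXE]; field_simp; ring
  have hmono : (Real.log 2 + Real.log (X + 2)) / (a * E) ≤ (Real.log 2 + Real.log (X + 2)) / a :=
    div_le_div_of_nonneg_left (by positivity) ha0 (by nlinarith)
  have hnum : (Real.log 2 + Real.log (X + 2)) / a ≤ (Real.log 2 + (Real.log 3 + (2 * a - 2))) / a :=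
    div_le_div_of_nonneg_right (by linarith) ha0.le
  have hA : (Real.log 2 + (Real.log 3 + (2 * a - 2))) / a ≤ 2 := by
    rw [div_le_iff₀ ha0]; linarith
  have h5 : 2 * Real.log 2 * E / a = 2 * (Real.log 2 * E / a) := by ring
  linarith [h1, hS]

/-- **THE EXPLICIT TRIVIAL-KEY FLOOR**: for `a ≥ 1` and `χ` mod `q ≠ 1`, `WeilPositivityOnChar χ a` and
`χ(n) = 1` for every prime power `n < e^{2a}` force `2 log 2 · e^{a−1}/a − 33/4 ≤ log q`.  RH/GRH-free. -/
theorem exp_floor_le_log_of_weilPositivityOnChar_of_trivial (hq : q ≠ 1) (χ : DirichletCharacter ℂ q)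
    (ha : 1 ≤ a) (hW : WeilPositivityOnChar χ a)
    (hkey : ∀ n ∈ weilPrimeIndex a, Λ n ≠ 0 → χ (n : ZMod q) = 1) :
    2 * Real.log 2 * Real.exp (a - 1) / a - 33 / 4 ≤ Real.log q := by
  have ha0 : 0 < a := by linarith
  have h1 := flatWindow_floor_le_log_of_weilPositivityOnChar_of_trivial hq χ ha0 hW hkey
  have h2 := two_mul_log_two_mul_exp_le_flatSum ha
  have h3 : 5 / a ≤ 5 := div_le_self (by norm_num) ha
  have h4 := Real.log_two_lt_d9
  linarith

/-- Contrapositive: for `a ≥ 1`, a rung at `a` with `log q < 2 log 2 · e^{a−1}/a − 33/4` NAMES a prime power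
`n < e^{2a}` with `χ(n) ≠ 1`. -/
theorem exists_vonMangoldt_ne_zero_chi_ne_one_of_lt_exp_floor (hq : q ≠ 1) (χ : DirichletCharacter ℂ q)
    (ha : 1 ≤ a) (hW : WeilPositivityOnChar χ a)
    (hlt : Real.log q < 2 * Real.log 2 * Real.exp (a - 1) / a - 33 / 4) :
    ∃ n ∈ weilPrimeIndex a, Λ n ≠ 0 ∧ χ (n : ZMod q) ≠ 1 := by
  by_contra h
  push Not at h
  exact (not_le.2 hlt) (exp_floor_le_log_of_weilPositivityOnChar_of_trivial hq χ ha hW h)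

/-! ## Under `GRH(χ)`: the least non-trivial prime power, in the classical shape -/

/-- **`GRH(χ)` ⟹ a prime power `n < x` with `χ(n) ≠ 1` as soon as `log q < (4 log 2/e)·√x/log x − 33/4`**
(`x ≥ e²`; `χ` primitive mod `q ≠ 1`).  The window is `a = (log x)/2`: `GRH(χ)` gives the rung
(`WeilPositivityChar.of_grh`), the flat window gives the floor, Chebyshev's `ψ` evaluates it.  So the least
character non-residue of `χ` (or the least prime dividing `q`) is `≪ (log q · log log q)²` — by Weil
POSITIVITY at one window. -/
theorem exists_primePower_lt_chi_ne_one_of_grh [NeZero q] (hq : q ≠ 1) {χ : DirichletCharacter ℂ q}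
    (hprim : χ.IsPrimitive) (hGRH : χ.RiemannHypothesis) {x : ℝ} (hx : Real.exp 2 ≤ x)
    (hlt : Real.log q < 4 * Real.log 2 / Real.exp 1 * Real.sqrt x / Real.log x - 33 / 4) :
    ∃ n : ℕ, (n : ℝ) < x ∧ Λ n ≠ 0 ∧ χ (n : ZMod q) ≠ 1 := by
  have hx0 : 0 < x := (Real.exp_pos 2).trans_le hx
  set a : ℝ := Real.log x / 2 with ha
  have ha1 : 1 ≤ a := by
    rw [ha, le_div_iff₀ two_pos, ← Real.log_exp (1 * 2)]
    exact Real.log_le_log (Real.exp_pos _) (by norm_num; exact hx)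
  have hW : WeilPositivityOnChar χ a := (WeilPositivityChar.of_grh hq hprim hGRH).on a
  -- the floor at `a = (log x)/2` is `(4 log 2/e)√x/log x − 33/4`
  have hfloor : 2 * Real.log 2 * Real.exp (a - 1) / a = 4 * Real.log 2 / Real.exp 1 * Real.sqrt x / Real.log x := by
    have hexp : Real.exp (a - 1) = Real.sqrt x / Real.exp 1 := by
      rw [Real.exp_sub, ha]
      congr 1
      symm
      rw [Real.sqrt_eq_iff_mul_self_eq_of_pos (Real.exp_pos _), ← Real.exp_add, add_halves, Real.exp_log hx0]
    rw [hexp, ha]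
    field_simp
    ring
  rw [← hfloor] at hlt
  obtain ⟨n, hn, hΛ, hχn⟩ := exists_vonMangoldt_ne_zero_chi_ne_one_of_lt_exp_floor hq χ ha1 hW hlt
  refine ⟨n, ?_, hΛ, hχn⟩
  have hlog : Real.log n < 2 * a := mem_weilPrimeIndex.1 hn
  rw [ha, mul_div_cancel₀ _ two_ne_zero] at hlog
  have hn0 : n ≠ 0 := by rintro rfl; simp at hΛ
  have hn1 : (0 : ℝ) < n := by exact_mod_cast Nat.pos_of_ne_zero hn0
  exact (Real.log_lt_log_iff hn1 hx0).1 hlog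

end Summit.Ventures.WeilGRH

end
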